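import Literature.Geometry.Lorentzian.CoordSigma2LaplacianEstimate
import Literature.Geometry.Lorentzian.CoordSigma2PathBounds
import Literature.Geometry.Lorentzian.CoordSigma2GradientAlgebra
import Literature.Analysis.Calculus.GlaeserInequality
import HarnessLib

/-!
# The gradient estimate for the `σ₂`-type conformal equation at a maximum point (coordinates)

Support file for the named fact
`Literature.Geometry.Riemannian.gurskyViaclovsky_gradientEstimate_weighted_four`
(Gursky–Viaclovsky 2003, Prop. 5: the a-priori `C¹` bound along the `σ₂`-continuity path, given
only an UPPER bound on the solution). In the coordinate language of `CoordCurvature.lean` (metric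
components `G` on an open `V` of the model space) the path equation reads, for the twisted
Schouten-type field `W = Hess f + df ⊗ df − ½|∇f|²G + B` (`B` a smooth symmetric background field),
`½ (c (tr_G W)² − |W|²_G) = Φ := a ω + b q e^{4f}` with `c ≥ 1`, `a, b > 0`, `ω ≥ 0`, `q ≥ q₀ > 0`.
This file carries out the maximum-principle computation of Gursky–Viaclovsky 2003, §4 (proof of
Prop. 5: "Consider the function `h = |∇u|²` … `0 ≥ ½ L^t_{ij} ∂_i∂_j g^{lm} u_l u_m + L^t_{ij}
u_{lij} u_l + L^t_{ij} u_{li} u_{lj}`", the once differentiated equation, "Lemma 2 in [Jeff4]"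
(the Ricci identity) and Lemma 2 = Li–Li / Guan–Wang: `T_{ij}u_{li}u_{lj} + ((1−t)/2)ΣT_{ll}
|∇²u|² ≥ β ΣT_{ll}|∇u|⁴`, "since `u` is bounded above, the `|∇u|⁴` term dominates") at a local
maximum `x` of `γ = |∇f|²_G`, in a `G x`-orthonormal EIGENFRAME of `Hess f` (so that Lemma 2 is the
pure cone algebra `sum_coneCoeff_mul_sq_ge` of `CoordSigma2GradientAlgebra.lean`):

* `IsMetricOn.hessAt_apply_sharp_eq_zero_of_isLocalMax` — the first-order condition
  `Hess f(·, ♯df) = 0` at a critical point of `|∇f|²`;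
* `IsMetricOn.hessAt_gradSqAt_frame_of_isLocalMax` — at such a point, in an eigenframe
  `Hess f(e_i, ·) = μ_i G(e_i, ·)`:
  `Hess |∇f|²(e_i,e_j) = 2[(∇_Z W)(e_i,e_j) − (∇_Z B)(e_i,e_j) − df(R(e_i,Z)e_j)] + 2 μ_i² δ_ij`,
  `Z = ♯df` (`hessAt_gradSqAt`, the Codazzi shift `cov₂At_hessAt_apply_sharp`);
* **`IsMetricOn.gradSqAt_le_of_isLocalMax`** (frame-entry form) and
  **`IsMetricOn.gradSqAt_le_of_isLocalMax_of_norm`** (norm form) — at a local maximum of `|∇f|²`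
  where `f(x) ≤ C₀`, with the frame entries of `B, ∇B, Rm, dq` bounded by `K` and Glaeser's bound
  `|dω(e_m)| ≤ K √ω` for the nonnegative weight: `|∇f|²(x) ≤ C(K, c₁, a, b, q₀, C₀)` explicitly.
  Every bad term carries the factor `tr_G W` because `√Φ ≤ √(c₁/2) tr_G W`, which is why no lower
  bound on `f` (no lower bound on `Φ`) is needed — exactly as in the source.

Everything is proved; no definition and no named fact is introduced.

## References

* M. J. Gursky, J. A. Viaclovsky, *A fully nonlinear equation on four-manifolds with positive
  scalar curvature*, J. Differential Geom. 63 (2003) 131–154, §4, Prop. 5 and Lemma 2.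
  [GurskyViaclovsky2003]
* A. Li, Y. Y. Li, *On some conformally invariant fully nonlinear equations*, Comm. Pure Appl.
  Math. 56 (2003) 1416–1464 (the gradient estimate, Lemma 2 of Gursky–Viaclovsky). [LiLi2003]
* P. Guan, G. Wang, *Local estimates for a class of fully nonlinear equations arising from
  conformal geometry*, Int. Math. Res. Not. 2003:26, 1413–1432. [GuanWang2003]
* S. Chen, *Local estimates for some fully nonlinear elliptic equations*, Int. Math. Res. Not.
  2005:63, 3937–3955, Thm. 1(a), Cor. 2. [Chen2005]
-/

noncomputable section

set_option maxSynthPendingDepth 3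

open Set Filter ContinuousLinearMap Module Finset
open scoped Topology ContDiff

namespace Literature.Geometry.Lorentzian

namespace MetricCoord

variable {E : Type*} [NormedAddCommGroup E] [NormedSpace ℝ E] [CompleteSpace E]
  [FiniteDimensional ℝ E] {G : E → E →L[ℝ] E →L[ℝ] ℝ} {V : Set E} {x : E} {f : E → ℝ}
  {Bf W : E → E →L[ℝ] E →L[ℝ] ℝ}

/-! ### Bookkeeping for the functional `t ↦ c w Σ_i t_ii − Σ_{ij} W_{ji} t_ij` on frame arrays -/

section Arrays

variable {ι : Type*} [Fintype ι]

/-- Splitting the functional over the combination `t = 2(A − B − R) + 2D` of arrays. [folklore] -/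
private theorem linComb_expand_grad (cw : ℝ) (Wm t A B R D : ι → ι → ℝ)
    (ht : ∀ i j, t i j = (A i j - B i j - R i j) * 2 + D i j * 2) :
    cw * ∑ i, t i i - ∑ i, ∑ j, Wm j i * t i j =
      ((cw * ∑ i, A i i - ∑ i, ∑ j, Wm j i * A i j)
        - (cw * ∑ i, B i i - ∑ i, ∑ j, Wm j i * B i j)
        - (cw * ∑ i, R i i - ∑ i, ∑ j, Wm j i * R i j)) * 2
      + (cw * ∑ i, D i i - ∑ i, ∑ j, Wm j i * D i j) * 2 := by
  simp only [ht, mul_add, mul_sub, sub_mul, ← mul_assoc, Finset.sum_add_distrib,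
    Finset.sum_sub_distrib, ← Finset.sum_mul]
  ring

/-- **`|c w Σ t_ii − Σ W_ji t_ij| ≤ 2 c w Σ |t_ij|`** when `|W_ij| ≤ c w`. [cite: Chen2005, §3] -/
private theorem abs_linComb_le_grad {cw : ℝ} (hcw : 0 ≤ cw) {Wm : ι → ι → ℝ}
    (hWm : ∀ i j, |Wm i j| ≤ cw) (t : ι → ι → ℝ) :
    |cw * ∑ i, t i i - ∑ i, ∑ j, Wm j i * t i j| ≤ 2 * cw * ∑ i, ∑ j, |t i j| := by
  have htr : |cw * ∑ i, t i i| ≤ cw * ∑ i, ∑ j, |t i j| := by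
    rw [abs_mul, abs_of_nonneg hcw]
    refine mul_le_mul_of_nonneg_left ((Finset.abs_sum_le_sum_abs _ _).trans
      (Finset.sum_le_sum fun i _ ↦ ?_)) hcw
    exact Finset.single_le_sum (f := fun j ↦ |t i j|) (fun _ _ ↦ abs_nonneg _)
      (Finset.mem_univ i)
  have hpr : |∑ i, ∑ j, Wm j i * t i j| ≤ cw * ∑ i, ∑ j, |t i j| := by
    rw [Finset.mul_sum]
    refine (Finset.abs_sum_le_sum_abs _ _).trans (Finset.sum_le_sum fun i _ ↦ ?_)
    rw [Finset.mul_sum]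
    refine (Finset.abs_sum_le_sum_abs _ _).trans (Finset.sum_le_sum fun j _ ↦ ?_)
    rw [abs_mul]
    exact mul_le_mul_of_nonneg_right (hWm j i) (abs_nonneg _)
  calc |cw * ∑ i, t i i - ∑ i, ∑ j, Wm j i * t i j|
      ≤ |cw * ∑ i, t i i| + |∑ i, ∑ j, Wm j i * t i j| := abs_sub _ _
    _ ≤ _ := by linarith

/-- `|Σ_m u_m v_m| ≤ a Σ_m |v_m|` when `|u_m| ≤ a`. [folklore] -/
private theorem abs_sum_mul_le_grad {u v : ι → ℝ} {a : ℝ} (hu : ∀ m, |u m| ≤ a) :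
    |∑ m, u m * v m| ≤ a * ∑ m, |v m| := by
  rw [Finset.mul_sum]
  refine (Finset.abs_sum_le_sum_abs _ _).trans (Finset.sum_le_sum fun m _ ↦ ?_)
  rw [abs_mul]
  exact mul_le_mul_of_nonneg_right (hu m) (abs_nonneg _)

/-- `Σ_m |v_m| ≤ n b` when `|v_m| ≤ b`. [folklore] -/
private theorem sum_abs_le_card_mul_grad {v : ι → ℝ} {b : ℝ} (hv : ∀ m, |v m| ≤ b) :
    ∑ m, |v m| ≤ Fintype.card ι * b :=
  (Finset.sum_le_sum fun m _ ↦ hv m).trans (by simp [Finset.card_univ])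

end Arrays

/-! ### The test function `|∇f|²` at a local maximum -/

omit [FiniteDimensional ℝ E] in
/-- **First-order condition** at a local maximum of `γ = |∇f|²`: `Hess f(Y, ♯df) = 0` for every
`Y` (Gursky–Viaclovsky 2003, §4, (goog)–(hip): `u_{li} u_l = 0` at the maximum point).
[cite: GurskyViaclovsky2003, §4, proof of Prop. 5] -/
theorem IsMetricOn.hessAt_apply_sharp_eq_zero_of_isLocalMax (hG : IsMetricOn G V) (hx : x ∈ V)
    (hf : ContDiffOn ℝ ∞ f V) (hmax : IsLocalMax (gradSqAt G f) x) (Y : E) :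
    hessAt G f x Y (sharpAt G x (fderiv ℝ f x)) = 0 := by
  have h0 := hmax.fderiv_eq_zero
  have h1 := congrArg (fun φ : E →L[ℝ] ℝ ↦ φ Y) h0
  simp only [_root_.zero_apply, hG.fderiv_gradSqAt hx hf] at h1
  linarith

omit [FiniteDimensional ℝ E] in
/-- **Second-order condition** at a local maximum of `γ = |∇f|²`: `Hess γ(v, v) ≤ 0`
(`Hess γ = D²γ` at a critical point). [cite: GurskyViaclovsky2003, §4, proof of Prop. 5] -/
theorem IsMetricOn.hessAt_gradSqAt_apply_self_nonpos_of_isLocalMax (hG : IsMetricOn G V)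
    (hx : x ∈ V) (hf : ContDiffOn ℝ ∞ f V) (hmax : IsLocalMax (gradSqAt G f) x) (v : E) :
    hessAt G (gradSqAt G f) x v v ≤ 0 := by
  have hL : ContDiffAt ℝ 2 (gradSqAt G f) x :=
    (((hG.contDiffOn_gradSqAt hf) x hx).contDiffAt (hG.mem_nhds hx)).of_le (by norm_cast)
  rw [hessAt_apply, hmax.fderiv_eq_zero, _root_.zero_apply, sub_zero]
  exact Literature.Topology.FourManifolds.IsLocalMax.fderiv_fderiv_apply_self_nonpos hL hmax v

variable {ι : Type*} [Fintype ι] [DecidableEq ι]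

omit [FiniteDimensional ℝ E] in
/-- **`Hess |∇f|²` at a critical point of `|∇f|²`, in an eigenframe of `Hess f`** (Gursky–Viaclovsky
2003, §4, (zonk) with (fullfirstder)–(firstderterm) and "Lemma 2 in [Jeff4]": `h_{ij} = u_{lij}u_l
+ u_{li}u_{lj}`, the third derivatives traded for `(∇_Z W)`, `(∇_Z B)` and curvature by the Ricci
identity): for a `G x`-orthonormal frame `e` with `Hess f(e_i, ·) = μ_i G(e_i, ·)` and `Z = ♯df`,
`Hess |∇f|²(e_i,e_j) = 2[(∇_Z W)(e_i,e_j) − (∇_Z B)(e_i,e_j) − df(R(e_i,Z)e_j)] + 2 μ_i² δ_ij`.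
[cite: GurskyViaclovsky2003, §4, proof of Prop. 5] -/
theorem IsMetricOn.hessAt_gradSqAt_frame_of_isLocalMax (hG : IsMetricOn G V) (hx : x ∈ V)
    (hf : ContDiffOn ℝ ∞ f V) (hB : ContDiffOn ℝ ∞ Bf V) (hW : W = (fun y ↦ hessAt G f y
      + ContinuousLinearMap.smulRightL ℝ E (E →L[ℝ] ℝ) (fderiv ℝ f y) (fderiv ℝ f y)
      - (1 / 2 : ℝ) • (gradSqAt G f y • G y) + Bf y)) (e : Basis ι ℝ E)
    (he : ∀ i j, G x (e i) (e j) = if i = j then 1 else 0) (μ : ι → ℝ)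
    (hμ : ∀ i w, hessAt G f x (e i) w = μ i * G x (e i) w)
    (hmax : IsLocalMax (gradSqAt G f) x) (i j : ι) :
    hessAt G (gradSqAt G f) x (e i) (e j) =
      2 * (cov₂At G W x (sharpAt G x (fderiv ℝ f x)) (e i) (e j)
        - cov₂At G Bf x (sharpAt G x (fderiv ℝ f x)) (e i) (e j)
        - fderiv ℝ f x (riemAt G x (e i) (sharpAt G x (fderiv ℝ f x)) (e j)))
      + 2 * (if i = j then μ i ^ 2 else 0) := by
  have hi : (G x).IsInvertible := hG.isInvertible x hx
  have hs : ∀ v w, G x v w = G x w v := hG.symm x hx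
  have hfx : ContDiffAt ℝ ∞ f x := (hf x hx).contDiffAt (hG.mem_nhds hx)
  have hcrit := hG.hessAt_apply_sharp_eq_zero_of_isLocalMax hx hf hmax
  set Z := sharpAt G x (fderiv ℝ f x) with hZ
  rw [hG.hessAt_gradSqAt hx hf (e i) (e j), hG.cov₂At_hessAt_apply_sharp hx hf hB hW (e i) (e j)]
  have h1 : hessAt G f x Z (e i) = 0 := by rw [hG.hessAt_comm hx hfx Z (e i)]; exact hcrit (e i)
  have h2 : hessAt G f x Z (e j) = 0 := by rw [hG.hessAt_comm hx hfx Z (e j)]; exact hcrit (e j)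
  have h3 : hessAt G f x Z Z = 0 := hcrit Z
  have h4 : hessAt G f x (e j) (sharpAt G x (hessAt G f x (e i))) = if i = j then μ i ^ 2 else 0 := by
    rw [apply_sharpAt_eq_sum_frame e he hi hs (hessAt G f x (e j)) (hessAt G f x (e i))]
    have : ∀ c, hessAt G f x (e i) (e c) * hessAt G f x (e j) (e c) =
        if i = c then (if i = j then μ i ^ 2 else 0) else 0 := by
      intro c
      rw [hμ i (e c), hμ j (e c), he i c, he j c]
      by_cases hic : i = c
      · subst hic
        by_cases hij : i = j
        · subst hij; simp; ring
        · simp [hij, Ne.symm hij]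
      · simp [hic]
    rw [Finset.sum_congr rfl fun c _ ↦ this c, Finset.sum_ite_eq, if_pos (Finset.mem_univ _)]
  rw [h1, h2, h3, h4, ← hZ]
  ring

/-! ### The estimate at a maximum point of `|∇f|²` -/

omit [CompleteSpace E] in
set_option maxHeartbeats 4000000 in
/-- **The gradient estimate for the `σ₂`-type equation at a maximum point of `|∇f|²`, frame-entry
form** (Gursky–Viaclovsky 2003, Prop. 5, proof in §4, with their Lemma 2). Setting: metric
components `G` on `V`, a point `x ∈ V` with `G x` positive definite and a `G x`-orthonormal
eigenframe `e` of `Hess f` (`Hess f(e_i, ·) = μ_i G(e_i, ·)`), `card ι = 4`; a smooth `f` and a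
smooth symmetric `B` with `W = Hess f + df⊗df − ½|∇f|²G + B` satisfying
`½(c (tr_G W)² − |W|²_G) = a ω + b q e^{4f}` on `V` (`1 ≤ c ≤ c₁`, `a, b > 0`, `ω(x) ≥ 0`,
`q(x) ≥ q₀ > 0`), `tr_G W(x) > 0`, `f(x) ≤ C₀`, and `x` a local maximum of `|∇f|²`. If the frame
entries at `x` of `B, ∇B, Rm, dq` are bounded by `K ≥ 0` and `|dω(e_m)| ≤ K √ω(x)` (Glaeser), then
`|∇f|²(x) ≤ 1 + 16K + 128 K Λ + 20480 c₁ K`, `Λ = a√(c₁/(2a)) + b e^{2C₀} √(c₁/(2 b q₀))`. Proof: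
`0 ≥ 𝔞_W(Hess |∇f|²)` (ellipticity, `linearization_nonpos`); `Hess |∇f|²` in the eigenframe
(`hessAt_gradSqAt_frame_of_isLocalMax`); `𝔞_W(∇_Z W) = dΦ(Z)` (the differentiated equation) whose
`e^{4f} df(Z) = e^{4f}|∇f|²` part is nonnegative; the cone algebra `Σ_i(c tr W − W_ii)μ_i² ≥
tr W |∇f|⁴/32` (Lemma 2); and every remaining term is `≤ tr W · (√|∇f|² + |∇f|²) · const` because
`|W_ij| ≤ c tr W`, `√ω ≤ √(c₁/(2a)) tr W` and `e^{2f} ≤ √(c₁/(2bq₀)) tr W`.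
[cite: GurskyViaclovsky2003, Prop. 5 and Lemma 2 (§4)] [cite: Chen2005, Thm. 1(a), Cor. 2] -/
theorem IsMetricOn.gradSqAt_le_of_isLocalMax (hG : IsMetricOn G V) (hx : x ∈ V)
    (hf : ContDiffOn ℝ ∞ f V) (hB : ContDiffOn ℝ ∞ Bf V)
    (hBs : ∀ y ∈ V, ∀ v w, Bf y v w = Bf y w v) (hW : W = (fun y ↦ hessAt G f y
      + ContinuousLinearMap.smulRightL ℝ E (E →L[ℝ] ℝ) (fderiv ℝ f y) (fderiv ℝ f y)
      - (1 / 2 : ℝ) • (gradSqAt G f y • G y) + Bf y))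
    (hpos : ∀ v, v ≠ 0 → 0 < G x v v) (e : Basis ι ℝ E)
    (he : ∀ i j, G x (e i) (e j) = if i = j then 1 else 0) (μ : ι → ℝ)
    (hμ : ∀ i w, hessAt G f x (e i) w = μ i * G x (e i) w)
    {wf qf : E → ℝ} {a b c c₁ K q₀ C₀ : ℝ} (ha : 0 < a) (hb : 0 < b) (hc : 1 ≤ c) (hc₁ : c ≤ c₁)
    (heq : ∀ y ∈ V, 1 / 2 * (c * mtrAt G y (W y) ^ 2 - pairAt G y (W y) (W y)) =
      a * wf y + b * (qf y * Real.exp (4 * f y)))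
    (hwfd : DifferentiableAt ℝ wf x) (hqfd : DifferentiableAt ℝ qf x) (hwf0 : 0 ≤ wf x)
    (hq₀ : 0 < q₀) (hq : q₀ ≤ qf x) (hfC : f x ≤ C₀) (hw : 0 < mtrAt G x (W x))
    (hmax : IsLocalMax (gradSqAt G f) x) (hn : Fintype.card ι = 4) (hK : 0 ≤ K)
    (hKB0 : ∀ i j, |Bf x (e i) (e j)| ≤ K)
    (hKB1 : ∀ m i j, |cov₂At G Bf x (e m) (e i) (e j)| ≤ K)
    (hKR : ∀ i m j p, |G x (riemAt G x (e i) (e m) (e j)) (e p)| ≤ K)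
    (hKw : ∀ m, |fderiv ℝ wf x (e m)| ≤ K * Real.sqrt (wf x))
    (hKq : ∀ m, |fderiv ℝ qf x (e m)| ≤ K) :
    gradSqAt G f x ≤ 1 + 16 * K
      + 128 * K * (a * Real.sqrt (c₁ / (2 * a)) + b * Real.exp (2 * C₀) * Real.sqrt (c₁ / (2 * b * q₀)))
      + 20480 * c₁ * K := by
  classical
  have hi : (G x).IsInvertible := hG.isInvertible x hx
  have hs : ∀ v w, G x v w = G x w v := hG.symm x hx
  have hfx : ContDiffAt ℝ ∞ f x := (hf x hx).contDiffAt (hG.mem_nhds hx)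
  have hfd : DifferentiableAt ℝ f x := hfx.differentiableAt (by simp)
  have hc0 : 0 < c := by linarith only [hc]
  have hc₁1 : 1 ≤ c₁ := hc.trans hc₁
  have hWc : ContDiffOn ℝ ∞ W V := hG.contDiffOn_schouten hf hB hW
  have hWs : ∀ y ∈ V, ∀ v w, W y v w = W y w v := fun y hy ↦ hG.schouten_symm hf hBs hW hy
  set w := mtrAt G x (W x) with hwdef
  set Z := sharpAt G x (fderiv ℝ f x) with hZdef
  set d : ι → ℝ := fun m ↦ fderiv ℝ f x (e m) with hddef
  set γ := gradSqAt G f x with hγdef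
  -- the frame expansions of `γ`, `Z` and of covectors
  have hγsum : γ = ∑ m, d m ^ 2 := gradSqAt_eq_sum_frame e he hi hs f
  have hγ0 : 0 ≤ γ := by rw [hγsum]; positivity
  have hZ : Z = ∑ m, d m • e m := sharpAt_eq_sum_frame e he hi hs (fderiv ℝ f x)
  have hdm : ∀ m, |d m| ≤ Real.sqrt γ := fun m ↦ by
    refine Real.abs_le_sqrt ?_
    rw [hγsum]
    exact Finset.single_le_sum (f := fun k ↦ d k ^ 2) (fun _ _ ↦ sq_nonneg _) (Finset.mem_univ m)
  have hDv : ∀ wv, fderiv ℝ f x wv = ∑ p, G x wv (e p) * d p := by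
    intro wv
    conv_lhs => rw [← sum_apply_smul_of_orthonormal e he wv]
    rw [map_sum]
    exact Finset.sum_congr rfl fun p _ ↦ by rw [map_smul, smul_eq_mul]
  -- the right-hand side at `x` and the cone condition
  have hΦdef : 1 / 2 * (c * w ^ 2 - normSqAt G x (W x)) = a * wf x + b * (qf x * Real.exp (4 * f x)) := by
    rw [← pairAt_self_of_symm G x (hWs x hx)]; exact heq x hx
  have hexp0 : 0 < Real.exp (4 * f x) := Real.exp_pos _
  have hqx : 0 < qf x := hq₀.trans_le hq
  have hΦpos : 0 < a * wf x + b * (qf x * Real.exp (4 * f x)) := by positivity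
  have hNW0 : 0 ≤ normSqAt G x (W x) := by
    rw [normSqAt_eq_sum_frame e he hi hs (W x)]; positivity
  have hcone : normSqAt G x (W x) < c * w ^ 2 := by nlinarith only [hΦdef, hΦpos, hNW0]
  have hΦle : a * wf x + b * (qf x * Real.exp (4 * f x)) ≤ c₁ * w ^ 2 / 2 := by
    have : c * w ^ 2 ≤ c₁ * w ^ 2 := mul_le_mul_of_nonneg_right hc₁ (sq_nonneg _)
    nlinarith only [hΦdef, hNW0, this]
  -- `√ω ≤ √(c₁/(2a)) w` and `e^{4f} ≤ e^{2C₀} √(c₁/(2bq₀)) w`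
  have hw0 : 0 ≤ w := hw.le
  have hsqw : Real.sqrt (wf x) ≤ Real.sqrt (c₁ / (2 * a)) * w := by
    have h1 : wf x ≤ c₁ / (2 * a) * w ^ 2 := by
      rw [div_mul_eq_mul_div, le_div_iff₀ (by positivity)]
      nlinarith only [hΦle, hb.le, hqx.le, hexp0.le, mul_nonneg (mul_nonneg hb.le hqx.le) hexp0.le]
    calc Real.sqrt (wf x) ≤ Real.sqrt (c₁ / (2 * a) * w ^ 2) := Real.sqrt_le_sqrt h1
      _ = Real.sqrt (c₁ / (2 * a)) * w := by
          rw [Real.sqrt_mul (by positivity), Real.sqrt_sq hw0]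
  have hexp4 : Real.exp (4 * f x) ≤ Real.exp (2 * C₀) * (Real.sqrt (c₁ / (2 * b * q₀)) * w) := by
    have h1 : Real.exp (4 * f x) ≤ c₁ / (2 * b * q₀) * w ^ 2 := by
      rw [div_mul_eq_mul_div, le_div_iff₀ (by positivity)]
      have h2 : b * (q₀ * Real.exp (4 * f x)) ≤ b * (qf x * Real.exp (4 * f x)) :=
        mul_le_mul_of_nonneg_left (mul_le_mul_of_nonneg_right hq hexp0.le) hb.le
      nlinarith only [hΦle, h2, mul_nonneg ha.le hwf0]
    have h2 : Real.exp (2 * f x) ≤ Real.sqrt (c₁ / (2 * b * q₀)) * w := by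
      have h3 : Real.exp (2 * f x) = Real.sqrt (Real.exp (4 * f x)) := by
        rw [show (4 : ℝ) * f x = 2 * f x + 2 * f x by ring, Real.exp_add,
          Real.sqrt_mul_self (Real.exp_pos _).le]
      rw [h3]
      calc Real.sqrt (Real.exp (4 * f x)) ≤ Real.sqrt (c₁ / (2 * b * q₀) * w ^ 2) := Real.sqrt_le_sqrt h1
        _ = Real.sqrt (c₁ / (2 * b * q₀)) * w := by
            rw [Real.sqrt_mul (by positivity), Real.sqrt_sq hw0]
    have h4 : Real.exp (2 * f x) ≤ Real.exp (2 * C₀) := Real.exp_le_exp.2 (by linarith only [hfC])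
    calc Real.exp (4 * f x) = Real.exp (2 * f x) * Real.exp (2 * f x) := by
          rw [← Real.exp_add]; ring_nf
      _ ≤ Real.exp (2 * C₀) * (Real.sqrt (c₁ / (2 * b * q₀)) * w) :=
          mul_le_mul h4 h2 (Real.exp_pos _).le (Real.exp_pos _).le
  -- Step 1: ellipticity `𝔞_W(Hess γ) ≤ 0`, in the frame
  have hγc : ContDiffAt ℝ ∞ (gradSqAt G f) x :=
    ((hG.contDiffOn_gradSqAt hf) x hx).contDiffAt (hG.mem_nhds hx)
  have hTs : ∀ v u, hessAt G (gradSqAt G f) x v u = hessAt G (gradSqAt G f) x u v :=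
    hG.hessAt_comm hx hγc
  have hA0 := linearization_nonpos hs hpos hTs
    (hG.hessAt_gradSqAt_apply_self_nonpos_of_isLocalMax hx hf hmax) hc hw hcone
  rw [← hwdef, mtrAt_eq_sum_frame e he hi (hessAt G (gradSqAt G f) x),
    pairAt_eq_sum_frame e he hi hs (W x) (hessAt G (gradSqAt G f) x)] at hA0
  -- Step 2: `Hess γ` in the eigenframe and the functional split over it
  have hT : ∀ i j, hessAt G (gradSqAt G f) x (e i) (e j) =
      (cov₂At G W x Z (e i) (e j) - cov₂At G Bf x Z (e i) (e j)
        - fderiv ℝ f x (riemAt G x (e i) Z (e j))) * 2 + (if i = j then μ i ^ 2 else 0) * 2 := by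
    intro i j
    rw [hG.hessAt_gradSqAt_frame_of_isLocalMax hx hf hB hW e he μ hμ hmax i j]
    ring
  have hexp := linComb_expand_grad (c * w) (fun i j ↦ W x (e i) (e j))
    (fun i j ↦ hessAt G (gradSqAt G f) x (e i) (e j)) (fun i j ↦ cov₂At G W x Z (e i) (e j))
    (fun i j ↦ cov₂At G Bf x Z (e i) (e j)) (fun i j ↦ fderiv ℝ f x (riemAt G x (e i) Z (e j)))
    (fun i j ↦ if i = j then μ i ^ 2 else 0) hT
  -- Step 3: `𝔞_W(∇_Z W) = dΦ(Z)` and `dΦ(Z) ≥ −(bad terms)`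
  have hA : c * w * ∑ i, cov₂At G W x Z (e i) (e i) - ∑ i, ∑ j, W x (e j) (e i) * cov₂At G W x Z (e i) (e j) =
      fderiv ℝ (fun z ↦ a * wf z + b * (qf z * Real.exp (4 * f z))) x Z := by
    rw [← hG.linearization_cov₂At_eq_fderiv hx hWc heq Z, mtrAt_eq_sum_frame e he hi (cov₂At G W x Z),
      pairAt_eq_sum_frame e he hi hs (W x) (cov₂At G W x Z)]
  have hDfZ : fderiv ℝ f x Z = γ := by rw [hγdef, gradSqAt_apply]
  have hwfZ : |fderiv ℝ wf x Z| ≤ Real.sqrt γ * (4 * (K * Real.sqrt (wf x))) := by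
    have h1 : fderiv ℝ wf x Z = ∑ m, d m * fderiv ℝ wf x (e m) := by
      rw [hZ]; simp only [map_sum, map_smul, smul_eq_mul]
    rw [h1]
    refine (abs_sum_mul_le_grad hdm).trans (mul_le_mul_of_nonneg_left ?_ (Real.sqrt_nonneg _))
    have := sum_abs_le_card_mul_grad hKw
    rw [hn] at this; push_cast at this; exact this
  have hqfZ : |fderiv ℝ qf x Z| ≤ Real.sqrt γ * (4 * K) := by
    have h1 : fderiv ℝ qf x Z = ∑ m, d m * fderiv ℝ qf x (e m) := by
      rw [hZ]; simp only [map_sum, map_smul, smul_eq_mul]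
    rw [h1]
    refine (abs_sum_mul_le_grad hdm).trans (mul_le_mul_of_nonneg_left ?_ (Real.sqrt_nonneg _))
    have := sum_abs_le_card_mul_grad hKq
    rw [hn] at this; push_cast at this; exact this
  have hΦZ : -(fderiv ℝ (fun z ↦ a * wf z + b * (qf z * Real.exp (4 * f z))) x Z) ≤
      w * Real.sqrt γ * (4 * K * (a * Real.sqrt (c₁ / (2 * a))
        + b * Real.exp (2 * C₀) * Real.sqrt (c₁ / (2 * b * q₀)))) := by
    rw [fderiv_rhs_apply hwfd hqfd hfd a b Z, hDfZ]
    have h1 : -(a * fderiv ℝ wf x Z) ≤ a * (Real.sqrt γ * (4 * (K * Real.sqrt (wf x)))) := by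
      have := neg_le_abs (fderiv ℝ wf x Z)
      nlinarith only [this, hwfZ, ha]
    have h2 : -(b * (fderiv ℝ qf x Z * Real.exp (4 * f x))) ≤ b * (Real.sqrt γ * (4 * K) * Real.exp (4 * f x)) := by
      have h21 : -fderiv ℝ qf x Z ≤ Real.sqrt γ * (4 * K) := (neg_le_abs _).trans hqfZ
      have h22 : -fderiv ℝ qf x Z * Real.exp (4 * f x) ≤ Real.sqrt γ * (4 * K) * Real.exp (4 * f x) :=
        mul_le_mul_of_nonneg_right h21 hexp0.le
      have h23 := mul_le_mul_of_nonneg_left h22 hb.le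
      linarith only [h23]
    have h3 : 0 ≤ b * (qf x * (4 * Real.exp (4 * f x) * γ)) := by positivity
    have h4 : a * (Real.sqrt γ * (4 * (K * Real.sqrt (wf x)))) ≤
        a * (Real.sqrt γ * (4 * (K * (Real.sqrt (c₁ / (2 * a)) * w)))) := by gcongr
    have h5 : b * (Real.sqrt γ * (4 * K) * Real.exp (4 * f x)) ≤
        b * (Real.sqrt γ * (4 * K) * (Real.exp (2 * C₀) * (Real.sqrt (c₁ / (2 * b * q₀)) * w))) := by gcongr
    nlinarith only [h1, h2, h3, h4, h5]
  -- Step 4: the junk arrays `(∇_Z B)(e_i,e_j)` and `df(R(e_i,Z)e_j)`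
  have hcw : 0 ≤ c * w := by positivity
  have hWm : ∀ i j, |W x (e i) (e j)| ≤ c * w := abs_apply_frame_le_of_cone e he hi hs hc hw.le hcone.le
  have hBZ : ∑ i, ∑ j, |cov₂At G Bf x Z (e i) (e j)| ≤ 64 * K * Real.sqrt γ := by
    have hent : ∀ i j, |cov₂At G Bf x Z (e i) (e j)| ≤ Real.sqrt γ * (4 * K) := by
      intro i j
      have h1 : cov₂At G Bf x Z (e i) (e j) = ∑ m, d m * cov₂At G Bf x (e m) (e i) (e j) := by
        rw [hZ]
        simp only [map_sum, map_smul, FunLike.coe_sum, Finset.sum_apply, FunLike.coe_smul,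
          Pi.smul_apply, smul_eq_mul]
      rw [h1]
      refine (abs_sum_mul_le_grad hdm).trans (mul_le_mul_of_nonneg_left ?_ (Real.sqrt_nonneg _))
      have := sum_abs_le_card_mul_grad fun m ↦ hKB1 m i j
      rw [hn] at this; push_cast at this; exact this
    calc ∑ i, ∑ j, |cov₂At G Bf x Z (e i) (e j)| ≤ ∑ _i : ι, ∑ _j : ι, Real.sqrt γ * (4 * K) :=
          Finset.sum_le_sum fun i _ ↦ Finset.sum_le_sum fun j _ ↦ hent i j
      _ = 64 * K * Real.sqrt γ := by
          simp only [Finset.sum_const, Finset.card_univ, hn, nsmul_eq_mul]; push_cast; ring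
  have hRZ : ∑ i, ∑ j, |fderiv ℝ f x (riemAt G x (e i) Z (e j))| ≤ 256 * K * γ := by
    have hDR : ∀ i m j, |fderiv ℝ f x (riemAt G x (e i) (e m) (e j))| ≤ Real.sqrt γ * (4 * K) := by
      intro i m j
      rw [hDv, show (∑ p, G x (riemAt G x (e i) (e m) (e j)) (e p) * d p) =
        ∑ p, d p * G x (riemAt G x (e i) (e m) (e j)) (e p) from Finset.sum_congr rfl fun p _ ↦ mul_comm _ _]
      refine (abs_sum_mul_le_grad hdm).trans (mul_le_mul_of_nonneg_left ?_ (Real.sqrt_nonneg _))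
      have := sum_abs_le_card_mul_grad fun p ↦ hKR i m j p
      rw [hn] at this; push_cast at this; exact this
    have hent : ∀ i j, |fderiv ℝ f x (riemAt G x (e i) Z (e j))| ≤ Real.sqrt γ * (4 * (Real.sqrt γ * (4 * K))) := by
      intro i j
      have h1 : fderiv ℝ f x (riemAt G x (e i) Z (e j)) = ∑ m, d m * fderiv ℝ f x (riemAt G x (e i) (e m) (e j)) := by
        rw [← riemCLM_apply G x (e i) Z, hZ]
        simp only [map_sum, map_smul, FunLike.coe_sum, Finset.sum_apply, FunLike.coe_smul,
          Pi.smul_apply, smul_eq_mul, riemCLM_apply]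
      rw [h1]
      refine (abs_sum_mul_le_grad hdm).trans (mul_le_mul_of_nonneg_left ?_ (Real.sqrt_nonneg _))
      have := sum_abs_le_card_mul_grad fun m ↦ hDR i m j
      rw [hn] at this; push_cast at this; exact this
    have hsq : Real.sqrt γ * Real.sqrt γ = γ := Real.mul_self_sqrt hγ0
    calc ∑ i, ∑ j, |fderiv ℝ f x (riemAt G x (e i) Z (e j))|
        ≤ ∑ _i : ι, ∑ _j : ι, Real.sqrt γ * (4 * (Real.sqrt γ * (4 * K))) :=
          Finset.sum_le_sum fun i _ ↦ Finset.sum_le_sum fun j _ ↦ hent i j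
      _ = 256 * K * γ := by
          simp only [Finset.sum_const, Finset.card_univ, hn, nsmul_eq_mul]; push_cast
          linear_combination (16 * 16 * K) * hsq
  have hAB := abs_linComb_le_grad hcw (Wm := fun i j ↦ W x (e i) (e j)) hWm (fun i j ↦ cov₂At G Bf x Z (e i) (e j))
  have hAR := abs_linComb_le_grad hcw (Wm := fun i j ↦ W x (e i) (e j)) hWm
    (fun i j ↦ fderiv ℝ f x (riemAt G x (e i) Z (e j)))
  beta_reduce at hAB hAR
  -- Step 5: the good term `Σ_i (c w − W_ii) μ_i²`
  have hD : c * w * ∑ i, (if i = i then μ i ^ 2 else 0) - ∑ i, ∑ j, W x (e j) (e i) * (if i = j then μ i ^ 2 else 0) =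
      ∑ i, (c * w - W x (e i) (e i)) * μ i ^ 2 := by
    have h1 : ∀ i, (∑ j, W x (e j) (e i) * (if i = j then μ i ^ 2 else 0)) = W x (e i) (e i) * μ i ^ 2 := by
      intro i
      rw [Finset.sum_eq_single i (fun j _ hji ↦ by rw [if_neg (Ne.symm hji), mul_zero])
        (fun h ↦ (h (Finset.mem_univ i)).elim), if_pos rfl]
    simp only [if_true, h1, Finset.mul_sum, ← Finset.sum_sub_distrib]
    exact Finset.sum_congr rfl fun i _ ↦ by ring
  -- Step 6: collecting, `Σ_i (c w − W_ii) μ_i² ≤ w (√γ A + γ B')`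
  have hmain : ∑ i, (c * w - W x (e i) (e i)) * μ i ^ 2 ≤
      w * Real.sqrt γ * (4 * K * (a * Real.sqrt (c₁ / (2 * a))
        + b * Real.exp (2 * C₀) * Real.sqrt (c₁ / (2 * b * q₀))))
      + 2 * (c₁ * w) * (64 * K * Real.sqrt γ) + 2 * (c₁ * w) * (256 * K * γ) := by
    have hc1w : c * w ≤ c₁ * w := mul_le_mul_of_nonneg_right hc₁ hw0
    have e1 : c * w * ∑ i, cov₂At G Bf x Z (e i) (e i) - ∑ i, ∑ j, W x (e j) (e i) * cov₂At G Bf x Z (e i) (e j) ≤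
        2 * (c₁ * w) * (64 * K * Real.sqrt γ) := (le_abs_self _).trans (hAB.trans (by gcongr))
    have e2 : c * w * ∑ i, fderiv ℝ f x (riemAt G x (e i) Z (e i)) - ∑ i, ∑ j, W x (e j) (e i) * fderiv ℝ f x (riemAt G x (e i) Z (e j)) ≤
        2 * (c₁ * w) * (256 * K * γ) := (le_abs_self _).trans (hAR.trans (by gcongr))
    rw [← hD]
    have hX := hA0
    rw [hexp, hA] at hX
    have hX2 : (c * w * ∑ i, (if i = i then μ i ^ 2 else 0)
        - ∑ i, ∑ j, W x (e j) (e i) * (if i = j then μ i ^ 2 else 0)) ≤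
        -(fderiv ℝ (fun z ↦ a * wf z + b * (qf z * Real.exp (4 * f z))) x Z)
        + (c * w * ∑ i, cov₂At G Bf x Z (e i) (e i) - ∑ i, ∑ j, W x (e j) (e i) * cov₂At G Bf x Z (e i) (e j))
        + (c * w * ∑ i, fderiv ℝ f x (riemAt G x (e i) Z (e i))
          - ∑ i, ∑ j, W x (e j) (e i) * fderiv ℝ f x (riemAt G x (e i) Z (e j))) := by
      linarith only [hX]
    exact hX2.trans (add_le_add (add_le_add hΦZ e1) e2)
  -- Step 7: the cone algebra (Lemma 2) and the conclusion
  by_cases hγK : γ < 16 * K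
  · have h1 : 0 ≤ 128 * K * (a * Real.sqrt (c₁ / (2 * a)) + b * Real.exp (2 * C₀) * Real.sqrt (c₁ / (2 * b * q₀))) := by
      positivity
    have h2 : 0 ≤ 20480 * c₁ * K := by positivity
    linarith only [hγK, h1, h2]
  · have hγK : 16 * K ≤ γ := le_of_not_gt hγK
    have hμd : ∀ i, μ i * d i = 0 := by
      intro i
      have h1 := hG.hessAt_apply_sharp_eq_zero_of_isLocalMax hx hf hmax (e i)
      rw [hμ i, apply_apply_sharpAt hi hs] at h1
      exact h1
    have hWij : ∀ i j, W x (e i) (e j) = (if i = j then μ i else 0) + d i * d j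
        - 1 / 2 * (∑ k, d k ^ 2) * (if i = j then 1 else 0) + Bf x (e i) (e j) := by
      intro i j
      rw [schouten_apply hW x (e i) (e j), hμ i (e j), he i j, ← hγsum]
      split_ifs <;> ring
    have hu : 0 < ∑ i, W x (e i) (e i) := by rwa [hwdef, mtrAt_eq_sum_frame e he hi (W x)] at hw
    have hcone' : ∑ i, ∑ j, W x (e i) (e j) ^ 2 < c * (∑ i, W x (e i) (e i)) ^ 2 := by
      rwa [normSqAt_eq_sum_frame e he hi hs (W x), hwdef, mtrAt_eq_sum_frame e he hi (W x)] at hcone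
    have hγK' : 16 * K ≤ ∑ k, d k ^ 2 := by rwa [hγsum] at hγK
    have key := sum_coneCoeff_mul_sq_ge hn μ d (fun i j ↦ Bf x (e i) (e j)) (fun i j ↦ W x (e i) (e j))
      hK hc hμd hKB0 hWij hu hcone' hγK'
    rw [← hγsum, ← mtrAt_eq_sum_frame e he hi (W x), ← hwdef] at key
    -- `w γ²/32 ≤ w (√γ A' + γ B')`, divide by `w > 0`, then use `γ ≥ 1 ∨ γ ≤ 1`
    have hcomb : w * γ ^ 2 / 32 ≤ w * Real.sqrt γ * (4 * K * (a * Real.sqrt (c₁ / (2 * a))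
        + b * Real.exp (2 * C₀) * Real.sqrt (c₁ / (2 * b * q₀))))
        + 2 * (c₁ * w) * (64 * K * Real.sqrt γ) + 2 * (c₁ * w) * (256 * K * γ) := key.trans hmain
    have hdiv : γ ^ 2 / 32 ≤ Real.sqrt γ * (4 * K * (a * Real.sqrt (c₁ / (2 * a))
        + b * Real.exp (2 * C₀) * Real.sqrt (c₁ / (2 * b * q₀))))
        + 2 * c₁ * (64 * K * Real.sqrt γ) + 2 * c₁ * (256 * K * γ) := by
      refine le_of_mul_le_mul_left ?_ hw
      nlinarith only [hcomb]
    by_cases hγ1 : γ ≤ 1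
    · have h1 : 0 ≤ 128 * K * (a * Real.sqrt (c₁ / (2 * a)) + b * Real.exp (2 * C₀) * Real.sqrt (c₁ / (2 * b * q₀))) := by
        positivity
      have h2 : 0 ≤ 20480 * c₁ * K := by positivity
      linarith only [hγ1, h1, h2, hK]
    · have hγ1 : 1 < γ := lt_of_not_ge hγ1
      have hsq1 : Real.sqrt γ ≤ γ := by
        rw [Real.sqrt_le_left hγ0] ; nlinarith only [hγ1]
      have hΛ0 : 0 ≤ 4 * K * (a * Real.sqrt (c₁ / (2 * a)) + b * Real.exp (2 * C₀) * Real.sqrt (c₁ / (2 * b * q₀))) := by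
        positivity
      have h3 : Real.sqrt γ * (4 * K * (a * Real.sqrt (c₁ / (2 * a))
          + b * Real.exp (2 * C₀) * Real.sqrt (c₁ / (2 * b * q₀)))) ≤ γ * (4 * K * (a * Real.sqrt (c₁ / (2 * a))
          + b * Real.exp (2 * C₀) * Real.sqrt (c₁ / (2 * b * q₀)))) := mul_le_mul_of_nonneg_right hsq1 hΛ0
      have h4 : 2 * c₁ * (64 * K * Real.sqrt γ) ≤ 2 * c₁ * (64 * K * γ) := by gcongr
      have h5 : γ ^ 2 / 32 ≤ γ * (4 * K * (a * Real.sqrt (c₁ / (2 * a))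
          + b * Real.exp (2 * C₀) * Real.sqrt (c₁ / (2 * b * q₀))) + 2 * c₁ * 64 * K + 2 * c₁ * 256 * K) := by
        nlinarith only [hdiv, h3, h4]
      have h6 : γ / 32 ≤ 4 * K * (a * Real.sqrt (c₁ / (2 * a))
          + b * Real.exp (2 * C₀) * Real.sqrt (c₁ / (2 * b * q₀))) + 2 * c₁ * 64 * K + 2 * c₁ * 256 * K := by
        have hγpos : 0 < γ := by linarith only [hγ1]
        have h7 : γ * (γ / 32) ≤ γ * (4 * K * (a * Real.sqrt (c₁ / (2 * a))
            + b * Real.exp (2 * C₀) * Real.sqrt (c₁ / (2 * b * q₀))) + 2 * c₁ * 64 * K + 2 * c₁ * 256 * K) := by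
          nlinarith only [h5]
        exact le_of_mul_le_mul_left h7 hγpos
      nlinarith only [h6, hK]

omit [CompleteSpace E] in
/-- **The gradient estimate at a maximum point of `|∇f|²`, norm form**: the same statement with the
bounds on `B, ∇B, Rm, dω, dq` given multilinearly in the norm of the model space and a bound
`‖e_a‖ ≤ κ` on the orthonormal eigenframe (so that every frame entry is at most `K κ⁴`); this is
the form a compactness argument on a manifold delivers.
[cite: GurskyViaclovsky2003, Prop. 5 and Lemma 2 (§4)] [cite: Chen2005, Thm. 1(a), Cor. 2] -/
theorem IsMetricOn.gradSqAt_le_of_isLocalMax_of_norm (hG : IsMetricOn G V) (hx : x ∈ V)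
    (hf : ContDiffOn ℝ ∞ f V) (hB : ContDiffOn ℝ ∞ Bf V)
    (hBs : ∀ y ∈ V, ∀ v w, Bf y v w = Bf y w v) (hW : W = (fun y ↦ hessAt G f y
      + ContinuousLinearMap.smulRightL ℝ E (E →L[ℝ] ℝ) (fderiv ℝ f y) (fderiv ℝ f y)
      - (1 / 2 : ℝ) • (gradSqAt G f y • G y) + Bf y))
    (hpos : ∀ v, v ≠ 0 → 0 < G x v v) (e : Basis ι ℝ E)
    (he : ∀ i j, G x (e i) (e j) = if i = j then 1 else 0) (μ : ι → ℝ)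
    (hμ : ∀ i w, hessAt G f x (e i) w = μ i * G x (e i) w)
    {wf qf : E → ℝ} {a b c c₁ K κ q₀ C₀ : ℝ} (ha : 0 < a) (hb : 0 < b) (hc : 1 ≤ c) (hc₁ : c ≤ c₁)
    (heq : ∀ y ∈ V, 1 / 2 * (c * mtrAt G y (W y) ^ 2 - pairAt G y (W y) (W y)) =
      a * wf y + b * (qf y * Real.exp (4 * f y)))
    (hwfd : DifferentiableAt ℝ wf x) (hqfd : DifferentiableAt ℝ qf x) (hwf0 : 0 ≤ wf x)
    (hq₀ : 0 < q₀) (hq : q₀ ≤ qf x) (hfC : f x ≤ C₀) (hw : 0 < mtrAt G x (W x))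
    (hmax : IsLocalMax (gradSqAt G f) x) (hn : Fintype.card ι = 4) (hκ : 1 ≤ κ)
    (heκ : ∀ m, ‖e m‖ ≤ κ) (hK : 0 ≤ K)
    (hB0 : ∀ X Y, |Bf x X Y| ≤ K * ‖X‖ * ‖Y‖)
    (hB1 : ∀ X Y U, |cov₂At G Bf x X Y U| ≤ K * ‖X‖ * ‖Y‖ * ‖U‖)
    (hR : ∀ X Y U U', |G x (riemAt G x X Y U) U'| ≤ K * ‖X‖ * ‖Y‖ * ‖U‖ * ‖U'‖)
    (hw1 : ∀ X, |fderiv ℝ wf x X| ≤ K * Real.sqrt (wf x) * ‖X‖)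
    (hq1 : ∀ X, |fderiv ℝ qf x X| ≤ K * ‖X‖) :
    gradSqAt G f x ≤ 1 + 16 * (K * κ ^ 4)
      + 128 * (K * κ ^ 4) * (a * Real.sqrt (c₁ / (2 * a))
        + b * Real.exp (2 * C₀) * Real.sqrt (c₁ / (2 * b * q₀)))
      + 20480 * c₁ * (K * κ ^ 4) := by
  have hκ0 : 0 ≤ κ := by linarith only [hκ]
  have key : ∀ (t : ℝ) (m : ℕ), t ≤ K * κ ^ m → m ≤ 4 → t ≤ K * κ ^ 4 := fun t m ht hm ↦
    ht.trans (mul_le_mul_of_nonneg_left (pow_le_pow_right₀ hκ hm) hK)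
  refine hG.gradSqAt_le_of_isLocalMax hx hf hB hBs hW hpos e he μ hμ ha hb hc hc₁ heq hwfd hqfd hwf0
    hq₀ hq hfC hw hmax hn (by positivity) ?_ ?_ ?_ ?_ ?_
  · intro i j
    refine key _ 2 ((hB0 _ _).trans ?_) (by norm_num)
    calc K * ‖e i‖ * ‖e j‖ ≤ K * κ * κ := by gcongr <;> exact heκ _
      _ = K * κ ^ 2 := by ring
  · intro m i j
    refine key _ 3 ((hB1 _ _ _).trans ?_) (by norm_num)
    calc K * ‖e m‖ * ‖e i‖ * ‖e j‖ ≤ K * κ * κ * κ := by gcongr <;> exact heκ _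
      _ = K * κ ^ 3 := by ring
  · intro i m j p
    refine key _ 4 ((hR _ _ _ _).trans ?_) le_rfl
    calc K * ‖e i‖ * ‖e m‖ * ‖e j‖ * ‖e p‖ ≤ K * κ * κ * κ * κ := by gcongr <;> exact heκ _
      _ = K * κ ^ 4 := by ring
  · intro m
    refine (hw1 _).trans ?_
    have h1 : K * Real.sqrt (wf x) * ‖e m‖ ≤ K * Real.sqrt (wf x) * κ ^ 4 := by
      refine mul_le_mul_of_nonneg_left ((heκ m).trans ?_) (by positivity)
      calc κ = κ ^ 1 := (pow_one κ).symm
        _ ≤ κ ^ 4 := pow_le_pow_right₀ hκ (by norm_num)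
    linarith only [h1]
  · intro m
    refine key _ 1 ((hq1 _).trans ?_) (by norm_num)
    calc K * ‖e m‖ ≤ K * κ := by gcongr; exact heκ _
      _ = K * κ ^ 1 := by ring

/-! ### The local gradient estimate for the `σ₂`-path equation on a compact coordinate set -/

omit [NormedSpace ℝ E] [CompleteSpace E] [FiniteDimensional ℝ E] in
/-- A uniform bound on a compact set for a field continuous on an open superset, made `≥ 0`.
[folklore] -/
private theorem exists_norm_le_of_continuousOn_grad {F : Type*} [NormedAddCommGroup F]
    {φ : E → F} {K : Set E} (hK : IsCompact K) (hφ : ContinuousOn φ K) :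
    ∃ C : ℝ, 0 ≤ C ∧ ∀ y ∈ K, ‖φ y‖ ≤ C := by
  obtain ⟨C, hC⟩ := hK.exists_bound_of_continuousOn hφ
  exact ⟨max C 0, le_max_right _ _, fun y hy ↦ (hC y hy).trans (le_max_left _ _)⟩

set_option maxHeartbeats 4000000 in
/-- **The local gradient estimate for the `σ₂`-path equation in coordinates** (Gursky–Viaclovsky
2003, Prop. 5, for the Weyl-weighted path; Chen 2005, Thm. 1(a) / Cor. 2: the constant is
independent of `t` and of `inf` of the right-hand side). For metric components `G`, `C^∞`, symmetric
and positive definite on an open `V` of a model space of dimension `4`, a compact `K ⊆ V`, smooth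
`ω ≥ 0` on `V` and smooth `q ≥ q₀ > 0` on `K`, and levels `C₀, δ`, there is ONE constant `C` such that
for every `t ∈ [δ, 1]` and every smooth `f` on `V` solving
`½(c_t (tr_G W)² − |W|²_G) = ω/16 + (q/4) e^{4f}` on `V`, `c_t = 1 + 3(1−t)(2−t)`,
`W = Hess f + df⊗df − ½|∇f|²G + ½(Ric − (R/6)G)`, with `tr_G W > 0` on `V`: at every local maximum
`y₀ ∈ K` of `|∇f|²_G` with `f(y₀) ≤ C₀` one has `|∇f|²_G(y₀) ≤ C`. The constant is the explicit one of
`gradSqAt_le_of_isLocalMax_of_norm` in the suprema over `K` of the operator norms of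
`G, G⁻¹, Rm, B, ∇B, dq` (continuity and compactness) and Glaeser's constant of `ω` on `K`
(`Literature.Analysis.Calculus.exists_norm_fderiv_le_mul_sqrt`), in the eigenframe of `Hess f(y₀)`
(`exists_orthonormal_eigenframe`). [cite: GurskyViaclovsky2003, Prop. 5] [cite: Chen2005, Thm. 1(a), Cor. 2] -/
theorem IsMetricOn.exists_gradSqAt_le_at_isLocalMax (hG : IsMetricOn G V) (hn : finrank ℝ E = 4)
    (hpos : ∀ y ∈ V, ∀ v, v ≠ 0 → 0 < G y v v) {K : Set E} (hK : IsCompact K) (hKV : K ⊆ V)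
    {wf qf : E → ℝ} (hwf : ContDiffOn ℝ ∞ wf V) (hqf : ContDiffOn ℝ ∞ qf V)
    (hwf0 : ∀ y ∈ V, 0 ≤ wf y) {q₀ : ℝ} (hq₀ : 0 < q₀) (hq : ∀ y ∈ K, q₀ ≤ qf y) (C₀ δ : ℝ) :
    ∃ C : ℝ, ∀ (t : ℝ), δ ≤ t → t ≤ 1 →
      ∀ (f : E → ℝ) (W : E → E →L[ℝ] E →L[ℝ] ℝ), ContDiffOn ℝ ∞ f V →
        W = (fun y ↦ hessAt G f y
          + ContinuousLinearMap.smulRightL ℝ E (E →L[ℝ] ℝ) (fderiv ℝ f y) (fderiv ℝ f y)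
          - (1 / 2 : ℝ) • (gradSqAt G f y • G y)
          + (1 / 2 : ℝ) • (ricAt G y - (scalAt G y / 6) • G y)) →
        (∀ y ∈ V, 1 / 2 * ((1 + 3 * ((1 - t) * (2 - t))) * mtrAt G y (W y) ^ 2
          - pairAt G y (W y) (W y)) = 1 / 16 * wf y + 1 / 4 * (qf y * Real.exp (4 * f y))) →
        (∀ y ∈ V, 0 < mtrAt G y (W y)) →
        ∀ y₀ ∈ K, f y₀ ≤ C₀ → IsLocalMax (gradSqAt G f) y₀ → gradSqAt G f y₀ ≤ C := by
  classical
  -- the background field `B = ½(Ric − (R/6) G)`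
  set Bf : E → E →L[ℝ] E →L[ℝ] ℝ := fun y ↦ (1 / 2 : ℝ) • (ricAt G y - (scalAt G y / 6) • G y)
    with hBf
  have hB : ContDiffOn ℝ ∞ Bf V := by
    refine fun y hy ↦ ((hG.contDiffOn_ricAt y hy).sub ?_).const_smul _
    exact ((hG.contDiffOn_scalAt y hy).div_const 6).smul (hG.contDiffOn y hy)
  have hBs : ∀ y ∈ V, ∀ v w, Bf y v w = Bf y w v := by
    intro y hy v w
    simp only [hBf, _root_.smul_apply, _root_.sub_apply, smul_eq_mul]
    rw [hG.ricAt_comm hy v w, hG.symm y hy v w]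
  have hτ : ContDiffOn ℝ ∞ (cov₂At G Bf) V := hG.contDiffOn_cov₂At hB
  -- uniform bounds on `K` (continuity and compactness), and Glaeser's constant for `ω`
  have hVo : IsOpen V := hG.isOpen
  obtain ⟨KG, hKG0, hKG⟩ := exists_norm_le_of_continuousOn_grad hK (hG.contDiffOn.continuousOn.mono hKV)
  obtain ⟨Ks, hKs0, hKs⟩ := exists_norm_le_of_continuousOn_grad hK
    (hG.contDiffOn_sharpAt.continuousOn.mono hKV)
  obtain ⟨KR, hKR0, hKR⟩ := exists_norm_le_of_continuousOn_grad hK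
    (hG.contDiffOn_riemCLM.continuousOn.mono hKV)
  obtain ⟨KB0, hKB00, hKB0⟩ := exists_norm_le_of_continuousOn_grad hK (hB.continuousOn.mono hKV)
  obtain ⟨KB1, hKB10, hKB1⟩ := exists_norm_le_of_continuousOn_grad hK (hτ.continuousOn.mono hKV)
  obtain ⟨Kq1, hKq10, hKq1⟩ := exists_norm_le_of_continuousOn_grad hK
    ((hqf.continuousOn_fderiv_of_isOpen hVo (by simp)).mono hKV)
  obtain ⟨Kw, hKw0, hKw⟩ := Literature.Analysis.Calculus.exists_norm_fderiv_le_mul_sqrt hVo hK hKV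
    (hwf.of_le (by norm_cast)) hwf0
  -- the constants (opaque local definitions)
  obtain ⟨κ, hκdef⟩ : ∃ κ : ℝ, κ = max 1 (Ks * ((1 + KG) / 2)) := ⟨_, rfl⟩
  have hκ1 : 1 ≤ κ := by rw [hκdef]; exact le_max_left _ _
  have hκ0 : 0 ≤ κ := zero_le_one.trans hκ1
  obtain ⟨Kall, hKalldef⟩ : ∃ k : ℝ, k = KB0 + KB1 + KG * KR + Kw + Kq1 := ⟨_, rfl⟩
  have hP : 0 ≤ KG * KR := by positivity
  have hKall0 : 0 ≤ Kall := by rw [hKalldef]; positivity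
  obtain ⟨c₁, hc₁def⟩ : ∃ c : ℝ, c = 1 + 3 * ((1 - δ) * (2 - δ)) := ⟨_, rfl⟩
  refine ⟨1 + 16 * (Kall * κ ^ 4)
      + 128 * (Kall * κ ^ 4) * (1 / 16 * Real.sqrt (c₁ / (2 * (1 / 16)))
        + 1 / 4 * Real.exp (2 * C₀) * Real.sqrt (c₁ / (2 * (1 / 4) * q₀)))
      + 20480 * c₁ * (Kall * κ ^ 4), ?_⟩
  intro t ht1 ht2 f W hf hW heq hw y₀ hy₀ hf0 hmax
  have hy : y₀ ∈ V := hKV hy₀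
  have hi : (G y₀).IsInvertible := hG.isInvertible y₀ hy
  have hs : ∀ v w, G y₀ v w = G y₀ w v := hG.symm y₀ hy
  have hposy := hpos y₀ hy
  have hnn : ∀ v, 0 ≤ G y₀ v v := fun v ↦ by
    by_cases hv : v = 0
    · simp [hv]
    · exact (hposy v hv).le
  -- smoothness at `y₀`
  have hfy : ContDiffAt ℝ ∞ f y₀ := (hf y₀ hy).contDiffAt (hG.mem_nhds hy)
  have hwfy : ContDiffAt ℝ ∞ wf y₀ := (hwf y₀ hy).contDiffAt (hG.mem_nhds hy)
  have hqfy : ContDiffAt ℝ ∞ qf y₀ := (hqf y₀ hy).contDiffAt (hG.mem_nhds hy)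
  have hwfd : DifferentiableAt ℝ wf y₀ := hwfy.differentiableAt (by simp)
  have hqfd : DifferentiableAt ℝ qf y₀ := hqfy.differentiableAt (by simp)
  -- an orthonormal eigenframe of `Hess f(y₀)`
  obtain ⟨e, μ, he, hμ⟩ := exists_orthonormal_eigenframe hs hposy (hessAt G f y₀) (hG.hessAt_comm hy hfy)
  have hcard : Fintype.card (Fin (finrank ℝ E)) = 4 := by rw [Fintype.card_fin, hn]
  have heκ : ∀ m, ‖e m‖ ≤ κ := fun m ↦ by
    have h1 := norm_le_of_apply_self_eq_one hi hs hnn (v := e m) (by rw [he, if_pos rfl])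
    rw [hκdef]
    refine h1.trans (le_trans ?_ (le_max_right _ _))
    exact mul_le_mul (hKs y₀ hy₀) (by linarith only [hKG y₀ hy₀]) (by positivity) hKs0
  -- the parameter `c_t`
  have h1t : 0 ≤ 1 - t := by linarith only [ht2]
  have h2t : 0 ≤ 2 - t := by linarith only [ht2]
  have hc : (1 : ℝ) ≤ 1 + 3 * ((1 - t) * (2 - t)) := by linarith only [mul_nonneg h1t h2t]
  have hcc₁ : 1 + 3 * ((1 - t) * (2 - t)) ≤ c₁ := by
    rw [hc₁def]
    have h3t : (0 : ℝ) ≤ 3 - δ - t := by linarith only [ht1, ht2]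
    linarith only [mul_nonneg (sub_nonneg.2 ht1) h3t]
  -- bounds by `Kall`
  have hle0 : KB0 ≤ Kall := by rw [hKalldef]; linarith only [hKB10, hP, hKw0, hKq10]
  have hle1 : KB1 ≤ Kall := by rw [hKalldef]; linarith only [hKB00, hP, hKw0, hKq10]
  have hleR : KG * KR ≤ Kall := by rw [hKalldef]; linarith only [hKB00, hKB10, hKw0, hKq10]
  have hlew : Kw ≤ Kall := by rw [hKalldef]; linarith only [hKB00, hKB10, hP, hKq10]
  have hleq : Kq1 ≤ Kall := by rw [hKalldef]; linarith only [hKB00, hKB10, hP, hKw0]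
  refine hG.gradSqAt_le_of_isLocalMax_of_norm hy hf hB hBs hW hposy e he μ hμ (a := 1 / 16)
    (b := 1 / 4) (by norm_num) (by norm_num) hc hcc₁ heq hwfd hqfd (hwf0 y₀ hy) hq₀ (hq y₀ hy₀) hf0
    (hw y₀ hy) hmax hcard hκ1 heκ hKall0 ?hB0 ?hB1 ?hR ?hw1 ?hq1
  case hB0 =>
    intro X Y
    have h1 : |Bf y₀ X Y| ≤ ‖Bf y₀‖ * ‖X‖ * ‖Y‖ := by
      rw [← Real.norm_eq_abs]; exact (Bf y₀).le_opNorm₂ X Y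
    refine h1.trans ?_
    have h2 : ‖Bf y₀‖ ≤ Kall := (hKB0 y₀ hy₀).trans hle0
    gcongr
  case hB1 =>
    intro X Y U
    have h1 : |cov₂At G Bf y₀ X Y U| ≤ ‖cov₂At G Bf y₀‖ * ‖X‖ * ‖Y‖ * ‖U‖ := by
      rw [← Real.norm_eq_abs]
      calc ‖cov₂At G Bf y₀ X Y U‖ ≤ ‖cov₂At G Bf y₀ X Y‖ * ‖U‖ := (cov₂At G Bf y₀ X Y).le_opNorm U
        _ ≤ ‖cov₂At G Bf y₀ X‖ * ‖Y‖ * ‖U‖ := by gcongr; exact (cov₂At G Bf y₀ X).le_opNorm Y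
        _ ≤ ‖cov₂At G Bf y₀‖ * ‖X‖ * ‖Y‖ * ‖U‖ := by gcongr; exact (cov₂At G Bf y₀).le_opNorm X
    refine h1.trans ?_
    have h2 : ‖cov₂At G Bf y₀‖ ≤ Kall := (hKB1 y₀ hy₀).trans hle1
    gcongr
  case hR =>
    intro X Y U U'
    refine (abs_apply_riemAt_le (G := G) (x := y₀) X Y U U').trans ?_
    have h2 : ‖G y₀‖ * ‖riemCLM G y₀‖ ≤ Kall :=
      (mul_le_mul (hKG y₀ hy₀) (hKR y₀ hy₀) (norm_nonneg _) hKG0).trans hleR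
    gcongr
  case hw1 =>
    intro X
    have h1 : |fderiv ℝ wf y₀ X| ≤ ‖fderiv ℝ wf y₀‖ * ‖X‖ := by
      rw [← Real.norm_eq_abs]; exact (fderiv ℝ wf y₀).le_opNorm X
    refine h1.trans (mul_le_mul_of_nonneg_right ((hKw y₀ hy₀).trans ?_) (norm_nonneg _))
    exact mul_le_mul_of_nonneg_right hlew (Real.sqrt_nonneg _)
  case hq1 =>
    intro X
    have h1 : |fderiv ℝ qf y₀ X| ≤ ‖fderiv ℝ qf y₀‖ * ‖X‖ := by
      rw [← Real.norm_eq_abs]; exact (fderiv ℝ qf y₀).le_opNorm X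
    exact h1.trans (mul_le_mul_of_nonneg_right ((hKq1 y₀ hy₀).trans hleq) (norm_nonneg _))

end MetricCoord

end Literature.Geometry.Lorentzian

end
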